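import Literature.Analysis.FluidPDE.ElgindiThetaZeroEstimates
import Literature.Analysis.FluidPDE.ElgindiAveragingOperators
import Literature.Analysis.Fourier.SincSmooth
import Mathlib.Analysis.Calculus.Deriv.Shift
import HarnessLib

/-!
# The degenerate end `θ = π/2` in the reflected variable `σ = π/2 − θ`: identities
([Elgindi2021] §7.1 Proposition 7.1; the structure `Ψ = cos θ·χ`)

Topic `Literature/Analysis/FluidPDE`. Support file (definitions with bodies and proved theorems, no
named facts) on the proof path of the named fact
`Literature.Analysis.FluidPDE.Elgindi.ElgindiGhoulMasmoudi2021_stabilityCore`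
(`ElgindiStabilityDecomposition.lean`). T. M. Elgindi, Ann. of Math. 194 (2021) =
arXiv:1904.04795, §7.1 Proposition 7.1 (p. 19) and §7 eq. (PolarBSL).

For a `TangentialFamily` we pass to `σ = π/2 − θ`: `w_k(R,σ) = V_k(R, π/2 − σ)` (`wRefl`), the
quotient `z_k = w_k/sin σ` (`zRefl`, i.e. `χ`-type profiles `V_k/cos θ`), the bounded combination
`n_k = 4w_k + D_R^kf̃ + α²(w_{k+2} − w_{k+1}) + α(5+α)w_{k+1}` (`nRefl`) and
`P_k = sin²σ∂_σw_k − sin σcos σ·w_k = sin³σ∂_σz_k` (`pRefl`). The polar equation becomes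
`∂_σσw_k = −cot σ∂_σw_k + w_k/sin²σ − (6w_k + f̃_k + α²(w_{k+2} − w_{k+1}) + α(5+α)w_{k+1})`
(`dθdθ_wRefl_eq`), whence the divergence form **`∂_σP_k = −sin²σ·n_k`** (`dθ_pRefl_eq`) and
`∂_σz_k = P_k/sin³σ` (`dθ_zRefl_eq`). All objects are `C^∞` on the strip.
-/

noncomputable section

open MeasureTheory Set Real Filter Function
open _root_.Topology
open scoped ContDiff

namespace Literature.Analysis.FluidPDE

namespace Elgindi

/-! ### Reflection `σ = π/2 − θ` -/

/-- The reflected function `g♭(R,σ) = g(R, π/2 − σ)`. [folklore] -/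
def refl (g : ℝ → ℝ → ℝ) : ℝ → ℝ → ℝ := fun R σ => g R (π / 2 - σ)

/-- Unfolding. [folklore] -/
theorem refl_apply (g : ℝ → ℝ → ℝ) (R σ : ℝ) : refl g R σ = g R (π / 2 - σ) := rfl

/-- The reflection maps the strip to itself. [folklore] -/
theorem refl_mem_strip {p : ℝ × ℝ} (hp : p ∈ strip) : ((p.1, π / 2 - p.2) : ℝ × ℝ) ∈ strip :=
  ⟨hp.1, by have := hp.2.2; simp only [mem_Ioo]; constructor <;> linarith [hp.2.1], ⟩

/-- `C^∞(strip)` is stable under reflection. [folklore] -/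
theorem contDiffOn_refl {g : ℝ → ℝ → ℝ} (hg : ContDiffOn ℝ ∞ (uncurry g) strip) : ContDiffOn ℝ ∞ (uncurry (refl g)) strip := by
  have e : uncurry (refl g) = uncurry g ∘ fun p : ℝ × ℝ => (p.1, π / 2 - p.2) := by funext p; rfl
  rw [e]
  exact hg.comp (contDiffOn_fst.prodMk (contDiffOn_const.sub contDiffOn_snd)) fun p hp => refl_mem_strip hp

/-- `∂_σ g♭ = −(∂_θg)♭` (everywhere). [folklore] -/
theorem dθ_refl (g : ℝ → ℝ → ℝ) : dθ (refl g) = fun R σ => -dθ g R (π / 2 - σ) := by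
  funext R σ
  show deriv (fun σ' => g R (π / 2 - σ')) σ = -deriv (fun θ' => g R θ') (π / 2 - σ)
  exact deriv_comp_const_sub (f := fun θ' => g R θ') (a := π / 2) (x := σ)

/-- `∂_σσ g♭ = (∂_θθg)♭` (everywhere). [folklore] -/
theorem dθ_dθ_refl (g : ℝ → ℝ → ℝ) : dθ (dθ (refl g)) = refl (dθ (dθ g)) := by
  rw [dθ_refl]
  funext R σ
  show deriv (fun σ' => -dθ g R (π / 2 - σ')) σ = dθ (dθ g) R (π / 2 - σ)
  have h1 : deriv (fun σ' => -dθ g R (π / 2 - σ')) σ = -deriv (fun σ' => dθ g R (π / 2 - σ')) σ := deriv.neg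
  have h2 : deriv (fun σ' => dθ g R (π / 2 - σ')) σ = -deriv (fun θ' => dθ g R θ') (π / 2 - σ) :=
    deriv_comp_const_sub (f := fun θ' => dθ g R θ') (a := π / 2) (x := σ)
  rw [h1, h2, neg_neg]; rfl

/-! ### The reflected family -/

/-- `w_k(R,σ) = V_k(R, π/2 − σ)`. [folklore] -/
def wRefl (Ψ : ℝ → ℝ → ℝ) (k : ℕ) : ℝ → ℝ → ℝ := refl (Dz^[k] Ψ)

/-- `z_k = w_k / sin σ` (the `χ`-profile `V_k/cos θ` in the reflected variable). [folklore] -/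
def zRefl (Ψ : ℝ → ℝ → ℝ) (k : ℕ) : ℝ → ℝ → ℝ := fun R σ => wRefl Ψ k R σ / Real.sin σ

/-- `n_k = 4w_k + (D_R^kf)♭ + α²(w_{k+2} − w_{k+1}) + α(5+α)w_{k+1}`. [folklore] -/
def nRefl (α : ℝ) (f Ψ : ℝ → ℝ → ℝ) (k : ℕ) : ℝ → ℝ → ℝ := fun R σ =>
  4 * wRefl Ψ k R σ + refl (Dz^[k] f) R σ + α ^ 2 * (wRefl Ψ (k + 2) R σ - wRefl Ψ (k + 1) R σ) + α * (5 + α) * wRefl Ψ (k + 1) R σ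

/-- `P_k = sin²σ·∂_σw_k − sin σ cos σ·w_k` (`= sin³σ·∂_σz_k`). [folklore] -/
def pRefl (Ψ : ℝ → ℝ → ℝ) (k : ℕ) : ℝ → ℝ → ℝ := fun R σ =>
  Real.sin σ ^ 2 * dθ (wRefl Ψ k) R σ - Real.sin σ * Real.cos σ * wRefl Ψ k R σ

namespace TangentialFamily

variable {α : ℝ} {f Ψ : ℝ → ℝ → ℝ} (h : TangentialFamily α f Ψ)
include h

/-- `w_k ∈ C^∞(strip)`. [folklore] -/
theorem smooth_wRefl (k : ℕ) : ContDiffOn ℝ ∞ (uncurry (wRefl Ψ k)) strip := contDiffOn_refl (h.smooth_iterate k)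

/-- `z_k ∈ C^∞(strip)`. [folklore] -/
theorem smooth_zRefl (k : ℕ) : ContDiffOn ℝ ∞ (uncurry (zRefl Ψ k)) strip := by
  have e : uncurry (zRefl Ψ k) = fun p : ℝ × ℝ => uncurry (wRefl Ψ k) p / Real.sin p.2 := by funext p; rfl
  rw [e]
  exact (h.smooth_wRefl k).div (by fun_prop) fun p hp => (Real.sin_pos_of_pos_of_lt_pi hp.2.1 (by linarith [hp.2.2, Real.pi_pos])).ne'

/-- The reflected datum is globally smooth. [folklore] -/
theorem smooth_refl_datum (k : ℕ) : ∀ n : ℕ, ContDiff ℝ n (uncurry (refl (Dz^[k] f))) := fun n => by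
  have e : uncurry (refl (Dz^[k] f)) = uncurry (Dz^[k] f) ∘ fun p : ℝ × ℝ => (p.1, π / 2 - p.2) := by funext p; rfl
  rw [e]
  exact (contDiff_iterate_Dz_of_contDiff (n := n) (m := k) (by simpa using h.datum_smooth (n + k))).comp
    (contDiff_fst.prodMk (contDiff_const.sub contDiff_snd))

/-- `n_k ∈ C^∞(strip)`. [folklore] -/
theorem smooth_nRefl (k : ℕ) : ContDiffOn ℝ ∞ (uncurry (nRefl α f Ψ k)) strip := by
  have e : uncurry (nRefl α f Ψ k) = fun p : ℝ × ℝ => 4 * uncurry (wRefl Ψ k) p + uncurry (refl (Dz^[k] f)) p +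
      α ^ 2 * (uncurry (wRefl Ψ (k + 2)) p - uncurry (wRefl Ψ (k + 1)) p) + α * (5 + α) * uncurry (wRefl Ψ (k + 1)) p := by
    funext p; rfl
  rw [e]
  have hd : ContDiffOn ℝ ∞ (uncurry (refl (Dz^[k] f))) strip := (contDiff_infty.2 (h.smooth_refl_datum k)).contDiffOn
  exact (((contDiffOn_const.mul (h.smooth_wRefl k)).add hd).add (contDiffOn_const.mul ((h.smooth_wRefl (k + 2)).sub (h.smooth_wRefl (k + 1))))).add
    (contDiffOn_const.mul (h.smooth_wRefl (k + 1)))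

/-- `P_k ∈ C^∞(strip)`. [folklore] -/
theorem smooth_pRefl (k : ℕ) : ContDiffOn ℝ ∞ (uncurry (pRefl Ψ k)) strip := by
  have e : uncurry (pRefl Ψ k) = fun p : ℝ × ℝ => Real.sin p.2 ^ 2 * uncurry (dθ (wRefl Ψ k)) p - Real.sin p.2 * Real.cos p.2 * uncurry (wRefl Ψ k) p := by
    funext p; rfl
  rw [e]
  exact ((by fun_prop : ContDiffOn ℝ ∞ (fun p : ℝ × ℝ => Real.sin p.2 ^ 2) strip).mul (contDiffOn_dθ_strip (h.smooth_wRefl k))).sub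
    ((by fun_prop : ContDiffOn ℝ ∞ (fun p : ℝ × ℝ => Real.sin p.2 * Real.cos p.2) strip).mul (h.smooth_wRefl k))

/-! ### The equation in the reflected variable -/

/-- **The polar equation in `σ`**: on the strip,
`∂_σσw_k = −cot σ·∂_σw_k + w_k/sin²σ − 6w_k − f̃_k − α²(w_{k+2} − w_{k+1}) − α(5+α)w_{k+1}`. [folklore] -/
theorem dθdθ_wRefl_eq (k : ℕ) {p : ℝ × ℝ} (hp : p ∈ strip) :
    dθ (dθ (wRefl Ψ k)) p.1 p.2 = -(Real.cos p.2 / Real.sin p.2) * dθ (wRefl Ψ k) p.1 p.2 + wRefl Ψ k p.1 p.2 / Real.sin p.2 ^ 2 -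
      6 * wRefl Ψ k p.1 p.2 - refl (Dz^[k] f) p.1 p.2 -
      α ^ 2 * (wRefl Ψ (k + 2) p.1 p.2 - wRefl Ψ (k + 1) p.1 p.2) - α * (5 + α) * wRefl Ψ (k + 1) p.1 p.2 := by
  have hq := refl_mem_strip hp
  have heq := h.dθdθ_iterate_eq k hq
  simp only at heq
  unfold wRefl
  rw [dθ_dθ_refl, refl_apply, heq, dθ_refl]
  simp only [refl_apply, Real.tan_eq_sin_div_cos, Real.sin_pi_div_two_sub, Real.cos_pi_div_two_sub]
  ring

/-- Slices of strip-smooth functions in `σ` have the expected derivative. [folklore] -/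
theorem hasDerivAt_sigma {g : ℝ → ℝ → ℝ} (hg : ContDiffOn ℝ ∞ (uncurry g) strip) {p : ℝ × ℝ} (hp : p ∈ strip) :
    HasDerivAt (fun σ' => g p.1 σ') (dθ g p.1 p.2) p.2 := by
  have := h
  have hd : DifferentiableAt ℝ (uncurry g) p := differentiableAt_of_contDiffOn_strip (contDiffOn_nat_of_infty hg 1) (by simp) hp
  have hc : HasDerivAt (fun θ' : ℝ => (p.1, θ')) ((0 : ℝ), (1 : ℝ)) p.2 := (hasDerivAt_const _ p.1).prodMk (hasDerivAt_id _)
  have hq : (p.1, p.2) = p := rfl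
  have h1 := (hq ▸ hd).hasFDerivAt.comp_hasDerivAt p.2 hc
  have e : (fun θ' => g p.1 θ') = uncurry g ∘ fun θ' => (p.1, θ') := rfl
  show HasDerivAt (fun θ' => g p.1 θ') (deriv (fun θ' => g p.1 θ') p.2) p.2
  rw [e, h1.deriv]; exact h1

/-- **The divergence form: `∂_σP_k = −sin²σ·n_k` on the strip.** [cite: Elgindi2021, §7.1 Proposition 7.1 (p. 19 of arXiv:1904.04795)] -/
theorem dθ_pRefl_eq (k : ℕ) {p : ℝ × ℝ} (hp : p ∈ strip) :
    dθ (pRefl Ψ k) p.1 p.2 = -Real.sin p.2 ^ 2 * nRefl α f Ψ k p.1 p.2 := by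
  have hsin : Real.sin p.2 ≠ 0 := (Real.sin_pos_of_pos_of_lt_pi hp.2.1 (by linarith [hp.2.2, Real.pi_pos])).ne'
  have hw : HasDerivAt (fun σ' => wRefl Ψ k p.1 σ') (dθ (wRefl Ψ k) p.1 p.2) p.2 := h.hasDerivAt_sigma (h.smooth_wRefl k) hp
  have hw' : HasDerivAt (fun σ' => dθ (wRefl Ψ k) p.1 σ') (dθ (dθ (wRefl Ψ k)) p.1 p.2) p.2 :=
    h.hasDerivAt_sigma (contDiffOn_dθ_strip (h.smooth_wRefl k)) hp
  have hs : HasDerivAt (fun σ' => Real.sin σ' ^ 2) (2 * Real.sin p.2 * Real.cos p.2) p.2 := by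
    have h0 : HasDerivAt (fun σ' => Real.sin σ' * Real.sin σ') (Real.cos p.2 * Real.sin p.2 + Real.sin p.2 * Real.cos p.2) p.2 :=
      (Real.hasDerivAt_sin p.2).mul (Real.hasDerivAt_sin p.2)
    have e : (fun σ' => Real.sin σ' ^ 2) = fun σ' => Real.sin σ' * Real.sin σ' := by funext σ'; ring
    rw [e]; refine h0.congr_deriv ?_; ring
  have hsc : HasDerivAt (fun σ' => Real.sin σ' * Real.cos σ') (Real.cos p.2 * Real.cos p.2 + Real.sin p.2 * -Real.sin p.2) p.2 :=
    (Real.hasDerivAt_sin p.2).mul (Real.hasDerivAt_cos p.2)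
  have hP : HasDerivAt (fun σ' => pRefl Ψ k p.1 σ')
      (2 * Real.sin p.2 * Real.cos p.2 * dθ (wRefl Ψ k) p.1 p.2 + Real.sin p.2 ^ 2 * dθ (dθ (wRefl Ψ k)) p.1 p.2 -
        ((Real.cos p.2 * Real.cos p.2 + Real.sin p.2 * -Real.sin p.2) * wRefl Ψ k p.1 p.2 + Real.sin p.2 * Real.cos p.2 * dθ (wRefl Ψ k) p.1 p.2)) p.2 :=
    (hs.mul hw').sub (hsc.mul hw)
  show deriv (fun σ' => pRefl Ψ k p.1 σ') p.2 = _
  rw [hP.deriv, h.dθdθ_wRefl_eq k hp]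
  unfold nRefl
  have hsc2 : Real.sin p.2 ^ 2 + Real.cos p.2 ^ 2 = 1 := Real.sin_sq_add_cos_sq p.2
  field_simp
  linear_combination (-(wRefl Ψ k p.1 p.2)) * hsc2

/-- **`∂_σz_k = P_k/sin³σ` on the strip.** [folklore] -/
theorem dθ_zRefl_eq (k : ℕ) {p : ℝ × ℝ} (hp : p ∈ strip) :
    dθ (zRefl Ψ k) p.1 p.2 = pRefl Ψ k p.1 p.2 / Real.sin p.2 ^ 3 := by
  have hsin : Real.sin p.2 ≠ 0 := (Real.sin_pos_of_pos_of_lt_pi hp.2.1 (by linarith [hp.2.2, Real.pi_pos])).ne'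
  have hw : HasDerivAt (fun σ' => wRefl Ψ k p.1 σ') (dθ (wRefl Ψ k) p.1 p.2) p.2 := h.hasDerivAt_sigma (h.smooth_wRefl k) hp
  have hz : HasDerivAt (fun σ' => wRefl Ψ k p.1 σ' / Real.sin σ')
      ((dθ (wRefl Ψ k) p.1 p.2 * Real.sin p.2 - wRefl Ψ k p.1 p.2 * Real.cos p.2) / Real.sin p.2 ^ 2) p.2 :=
    hw.div (Real.hasDerivAt_sin p.2) hsin
  show deriv (fun σ' => wRefl Ψ k p.1 σ' / Real.sin σ') p.2 = _
  rw [hz.deriv]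
  unfold pRefl
  field_simp

/-- **`P_k = sin³σ·∂_σz_k` on the strip.** [folklore] -/
theorem pRefl_eq (k : ℕ) {p : ℝ × ℝ} (hp : p ∈ strip) : pRefl Ψ k p.1 p.2 = Real.sin p.2 ^ 3 * dθ (zRefl Ψ k) p.1 p.2 := by
  have hsin : Real.sin p.2 ≠ 0 := (Real.sin_pos_of_pos_of_lt_pi hp.2.1 (by linarith [hp.2.2, Real.pi_pos])).ne'
  rw [h.dθ_zRefl_eq k hp]; field_simp

omit h in
/-- `w_k = sin σ·z_k` on the strip. [folklore] -/
theorem wRefl_eq (k : ℕ) {p : ℝ × ℝ} (hp : p ∈ strip) : wRefl Ψ k p.1 p.2 = Real.sin p.2 * zRefl Ψ k p.1 p.2 := by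
  have hsin : Real.sin p.2 ≠ 0 := (Real.sin_pos_of_pos_of_lt_pi hp.2.1 (by linarith [hp.2.2, Real.pi_pos])).ne'
  unfold zRefl; field_simp

end TangentialFamily

end Elgindi

end Literature.Analysis.FluidPDE
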